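import Literature.AlgebraicGeometry.ComplexMultiplication.CMTypeReducedDegree
import Literature.RingTheory.CentralSimple.ReducedDegreeCentralizerSimpleSubalgebra
import Literature.AlgebraicGeometry.HodgeTheory.QuaternionMinimalPowersHodgeClasses
import Literature.NumberTheory.ComplexMultiplication.CMAlgebraTorusSimpleSubalgebraRosatiStable
import HarnessLib

/-!
# Complex multiplication relative to a simple subalgebra `L ⊆ End⁰(A)`: étale subalgebras of `End⁰_L(A)` have dimension
# `≤ 2 dim A / d`, with equality for some iff `A` has complex multiplication (Milne, *Complex Multiplication*, Ch. I
# §3 Exercise 3.10 (a)) — for complex abelian varieties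

Family `hodge`, lane `lit-hodgefound` (Track 2 foundations library; skeleton seat `lit-hodgefound-skel-3`, generation 59,
row **A3-G143** «Milne CM Ex. 3.10 (a)»), layer `Literature/AlgebraicGeometry/ComplexMultiplication`, namespace
`Literature.AlgebraicGeometry.ComplexMultiplication`.  FILE 3 of the row: the statement AS PRINTED, for a complex abelian
variety `A : AbelianVariety ℂ` of the tree (`End⁰(A) = A.endAlgebra`, «`A` has complex multiplication» =
`Milne1999.IsOfCMType A` ⟺ `[End⁰(A) : ℚ]_red = 2 dim A`, A3-G141 `isOfCMType_iff_reducedDegree_eq`).  It consumes BY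
NAME FILE 1 (`RingTheory/CentralSimple/ReducedDegreeCentralizerSimpleSubalgebra`: `mul_finrank_le_of_le_centralizer`,
`mul_reducedDegree_centralizer_union_eq`, `centralizer_comm_of_mul_finrank_eq` in the central simple algebra
`End_ℚ H¹(A(ℂ); ℚ)`), A3-G140 FILE 3 (`CMTypeCommutantCriterion.isOfCMType_iff_centralizer_comm`: Milne Prop. 3.3 (a) ⟺
(c) on `H¹`), A3-G141 FILE 2 (`CMTypeReducedDegree.isOfCMType_iff_reducedDegree_eq`), the rational representation
`bettiRepOp A : End⁰(A)ᵐᵒᵖ ↪ End_ℚ H¹(A(ℂ); ℚ)` (`HodgeTheory/HodgeEndomorphismsHOneOfRiemann`, `bettiRepOp_injective`;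
`finrank_bettiCohomology_one`: `dim_ℚ H¹ = 2 dim A`), Poincaré–Mumford semisimplicity
(`AbelianVariety.isSemisimpleRing_endAlgebra_of_isAlgClosed`) and p11's bicommutant theorem
(`SemisimpleCentralizer.centralizer_centralizer_eq_of_isSemisimpleRing`, `isSemisimpleRing_centralizer_of_isSemisimpleRing`).
THEOREMS ONLY (no definition, no instance, no named fact; net debt 0, D-0026).

## The print

J. S. Milne, *Complex Multiplication* (course notes v0.10, 2020) [MilneCM2006], Ch. I §3 p. 29 (open text
`paper:url-8ccc30e4daab`, p0029), VERBATIM: «EXERCISE 3.10 Let `L` be a simple `ℚ`-algebra of finite degree `d²` over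
its centre `F`, and let `A` be an abelian variety containing `L` in its endomorphism algebra.  (a) Show that for any
semisimple commutative `ℚ`-subalgebra `R` of `End⁰_L(A)`, `dim_ℚ R ≤ (2 dim A)/d`, and that equality holds for some `R`
if and only [if] `A` has complex multiplication.»  (`End⁰_L(A)` = the commutant of `L` in `End⁰(A)`; «semisimple
commutative» = commutative reduced, as in every `reducedDegree` file of the tree; «complex multiplication» = Def. 3.2
`2 dim A = [End⁰(A) : ℚ]_red` ⟺ Prop. 3.3 (b) «`End⁰(A)` contains an étale subalgebra of degree `2 dim A`» = the tree's
`IsOfCMType A`.)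

## Proof route (pushed into `B = End_ℚ H¹(A(ℂ); ℚ)`, central simple of degree `n = 2 dim A`, along `f ↦ f^*`)

Write `S♯ = (Sᵒᵖ)^* ⊆ B` for the image of a subalgebra `S ⊆ End⁰(A)` under the (injective, contravariant) rational
representation; `S♯ ≃ Sᵐᵒᵖ`, so `S♯` is simple ∕ commutative ∕ reduced when `S` is, of the same dimension and with a
centre of the same dimension (§1).  The BOUND is FILE 1's `d·[C_B(L♯) : ℚ]_red = n` applied to `R♯ ⊆ C_B(L♯)`.  «CM ⟹
equality»: the commutant `Z = C_B(End⁰(A)♯)` is semisimple (bicommutant theory of the semisimple `End⁰(A)`) and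
commutative (Prop. 3.3 (c)), hence reduced; FILE 1 (B2) gives `d·[C_B(Z ∪ L♯)]_red = n`, and `C_B(Z ∪ L♯) = C_B(Z) ⊓
C_B(L♯) = End⁰(A)♯ ⊓ C_B(L♯) = (End⁰_L(A))♯` by the bicommutant theorem.  «equality ⟹ CM»: FILE 1 (B3) makes the
commutant of `End⁰(A)♯ ⊇ R♯ ∪ L♯` commutative, which is CM by Prop. 3.3 (c) ⟹ (a) (A3-G140).  The torus-level twin,
for every complex torus, is FILE 2 (`NumberTheory/ComplexMultiplication/CMAlgebraTorusSimpleSubalgebraCommutant`).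

## What is formalised (`A : AbelianVariety ℂ`; `L ≤ End⁰(A)` simple with `[L : ℚ] = d²·[Z(L) : ℚ]`)

* §2 **the bound** `mul_finrank_le_two_mul_dim_of_le_centralizer` (every commutative reduced `R ⊆ End⁰_L(A)` has
  `d·dim_ℚ R ≤ 2 dim A`), `mul_reducedDegree_centralizer_le_two_mul_dim` (`d·[End⁰_L(A) : ℚ]_red ≤ 2 dim A`).
* §3 **CM ⟹ equality** `mul_reducedDegree_centralizer_eq_two_mul_dim_of_isOfCMType`,
  `exists_le_centralizer_mul_finrank_eq_two_mul_dim_of_isOfCMType`.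
* §4 **equality ⟹ CM** `isOfCMType_of_mul_finrank_eq_two_mul_dim`.
* §5 **EX. 3.10 (a) as equivalences** `exists_mul_finrank_eq_two_mul_dim_iff_isOfCMType`,
  `mul_reducedDegree_centralizer_eq_two_mul_dim_iff_isOfCMType` (the relative Def. 3.2),
  `mul_reducedDegree_centralizer_eq_two_mul_dim_iff_reducedDegree_eq`; the case of a CENTRAL simple `L`
  (`[L : ℚ] = d²`) `exists_mul_finrank_eq_two_mul_dim_iff_isOfCMType_of_isCentral`, and the case `d = 1` of a commutative
  simple `L` (a subfield of `End⁰(A)`) `exists_finrank_eq_two_mul_dim_iff_isOfCMType_of_comm`.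
* §6 (row A3-G147, generation 62) **EX. 3.10 (b): «Let `′` be a Rosati involution on `End⁰(A)` stabilizing `L`; show
  that, if `A` has complex multiplication, then there is an `R` as in (a) that is stabilized by `′`.»** — for the
  Rosati involution of a polarization `ψ` of `H¹(A(ℂ); ℚ)` (the model layer's `AbelianVariety.rosati`, `(a′)^* = (a^*)†`):
  ★★★ `exists_rosati_stable_le_centralizer_mul_finrank_eq_two_mul_dim_of_isOfCMType` (CM, `L′ = L` ⟹ a commutative
  reduced `R ⊆ End⁰_L(A)` with `d · dim_ℚ R = 2 dim A` and `R′ = R`), the iff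
  `exists_rosati_stable_mul_finrank_eq_two_mul_dim_iff_isOfCMType`, and the case `L = ℚ`
  `exists_rosati_stable_finrank_eq_two_mul_dim_of_isOfCMType` (Prop. 3.6 (c)'s clause «invariant under some Rosati
  involution», here for EVERY polarization; the CM-algebra refinement is not asserted).  Route: in `B = End_ℚ H¹` the
  commutant `Z` of `End⁰(A)♯` is commutative reduced and `†`-stable, `S = ℚ[L♯ ∪ Z]` is `†`-stable and semisimple
  (`NumberTheory/ComplexMultiplication/CMAlgebraTorusSimpleSubalgebraRosatiStable.isSemisimpleRing_adjoin_union_of_comm_isReduced`),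
  and `RingTheory/SimpleModule/CommutantAdjointStableMaximalEtale.exists_subalgebra_comm_reduced_maximal_adjoint_stable`
  (Cimprič 2008 Lemma 5 in the block algebra of an orthogonal decomposition of the semisimple `S`-module `H¹`) gives a
  `†`-stable commutative reduced `R ⊆ C_B(S)`, maximal commutative; `Z ⊆ R`, so `R` is maximal étale in the simple
  `C_B(L♯)` and `d · dim R = dim H¹ = 2 dim A`; pull back along `a ↦ a^*`.  (These two imports bring the model layer
  `HodgeTheory/QuaternionMinimalPowersHodgeClasses` and the torus-level files into this file's closure.)

## References

* [MilneCM2006] J. S. Milne, *Complex Multiplication* (2006/2020), Ch. I §3 Exercise 3.10 (a) (p. 29); Prop. 3.1,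
  Def. 3.2, Prop. 3.3 (pp. 27–28).
* [MumfordAV1970] D. Mumford, *Abelian Varieties* (1970), §19 Thm. 3, Cor. 1–2 (finite-dimensionality and the faithful
  rational representation), §19 Cor. of Thm. 1 ∕ §21 (semisimplicity of `End⁰`).
* [Voight2021] J. Voight, *Quaternion Algebras*, GTM 288 (2021), §7.7 Prop. 7.7.8.
* [BourbakiAlgebreVIII2012] N. Bourbaki, *Algèbre* Ch. VIII (2012), §14 n°7 Prop. 4 a), Cor. 1.
* [Cimpric2008FormallyRealInvolutions] J. Cimprič, *Formally real involutions on central simple algebras*, Comm. Algebra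
  36 (2008) 165–178 (arXiv:0807.5017), §2 Lemma 5 (an involution-stable maximal subfield) — §6.
* [Lange2023AbelianVarietiesComplex] H. Lange, *Abelian Varieties over the Complex Numbers* (2023), §2.4.1 Prop. 2.4.2
  (the Rosati involution is the adjoint for the Riemann form) — §6.
* [MilneCM2006] (again) Ch. I §3 Exercise 3.10 (b) (p. 29), Prop. 3.6 (c) (p. 28) — §6.
-/

noncomputable section

open Module
open scoped TensorProduct

namespace Literature.AlgebraicGeometry.ComplexMultiplication

open Literature.AlgebraicGeometry.Motives Literature.AlgebraicGeometry.HodgeTheory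
open Literature.AlgebraicGeometry.Milne1999 (IsOfCMType)
open Literature.RingTheory.CentralSimple

universe u v w

/-! ## §0 Plumbing: algebras anti-isomorphic to one another -/

section Anti

variable {F : Type u} [Field F] {X : Type v} [Ring X] [Algebra F X] {Y : Type w} [Ring Y] [Algebra F Y]

/-- An anti-isomorphism preserves the dimension. [folklore] -/
private theorem finrank_eq_of_algEquiv_mop (e : X ≃ₐ[F] Yᵐᵒᵖ) : finrank F X = finrank F Y :=
  (e.toLinearEquiv.trans (MulOpposite.opLinearEquiv F).symm).finrank_eq

/-- An anti-isomorphism preserves the dimension of the centre. [folklore] -/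
private theorem finrank_center_eq_of_algEquiv_mop (e : X ≃ₐ[F] Yᵐᵒᵖ) :
    finrank F ↥(Subalgebra.center F X) = finrank F ↥(Subalgebra.center F Y) := by
  have h1 : ∀ x : ↥(Subalgebra.center F X), MulOpposite.unop (e x) ∈ Subalgebra.center F Y := by
    intro x
    rw [Subalgebra.mem_center_iff]
    intro b
    have hx := Subalgebra.mem_center_iff.1 x.2 (e.symm (MulOpposite.op b))
    have h := congrArg e hx
    rw [map_mul, map_mul, AlgEquiv.apply_symm_apply] at h
    -- `h : op b * e x = e x * op b`
    have h' := congrArg MulOpposite.unop h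
    rw [MulOpposite.unop_mul, MulOpposite.unop_mul, MulOpposite.unop_op] at h'
    exact h'.symm
  have h2 : ∀ y : ↥(Subalgebra.center F Y), e.symm (MulOpposite.op (y : Y)) ∈ Subalgebra.center F X := by
    intro y
    rw [Subalgebra.mem_center_iff]
    intro b
    apply e.injective
    rw [map_mul, map_mul, AlgEquiv.apply_symm_apply]
    induction h : e b using MulOpposite.rec' with
    | h c =>
      rw [← MulOpposite.op_mul, ← MulOpposite.op_mul, Subalgebra.mem_center_iff.1 y.2 c]
  refine LinearEquiv.finrank_eq
    { toFun := fun x => ⟨MulOpposite.unop (e x), h1 x⟩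
      map_add' := fun x y => Subtype.ext (by
        change MulOpposite.unop (e (x + y)) = MulOpposite.unop (e x) + MulOpposite.unop (e y)
        rw [map_add, MulOpposite.unop_add])
      map_smul' := fun r x => Subtype.ext (by
        change MulOpposite.unop (e (r • (x : X))) = r • MulOpposite.unop (e x)
        rw [map_smul, MulOpposite.unop_smul])
      invFun := fun y => ⟨e.symm (MulOpposite.op (y : Y)), h2 y⟩
      left_inv := fun x => Subtype.ext (by
        change e.symm (MulOpposite.op (MulOpposite.unop (e x))) = x
        rw [MulOpposite.op_unop, AlgEquiv.symm_apply_apply])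
      right_inv := fun y => Subtype.ext (by
        change MulOpposite.unop (e (e.symm (MulOpposite.op (y : Y)))) = y
        rw [AlgEquiv.apply_symm_apply, MulOpposite.unop_op]) }

/-- An algebra anti-isomorphic to a simple algebra is simple. [folklore] -/
private theorem isSimpleRing_of_algEquiv_mop (e : X ≃ₐ[F] Yᵐᵒᵖ) [IsSimpleRing Y] : IsSimpleRing X :=
  IsSimpleRing.of_ringEquiv e.symm.toRingEquiv inferInstance

/-- An algebra anti-isomorphic to a reduced algebra is reduced. [folklore] -/
private theorem isReduced_of_algEquiv_mop (e : X ≃ₐ[F] Yᵐᵒᵖ) [hY : IsReduced Y] : IsReduced X := by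
  refine ⟨fun x hx => ?_⟩
  obtain ⟨n, hn⟩ := hx
  have h : (MulOpposite.unop (e x)) ^ n = 0 := by
    rw [← MulOpposite.unop_pow, ← map_pow, hn, map_zero, MulOpposite.unop_zero]
  have h0 : MulOpposite.unop (e x) = 0 := hY.eq_zero _ ⟨n, h⟩
  apply e.injective
  rw [map_zero, ← MulOpposite.op_unop (e x), h0, MulOpposite.op_zero]

/-- An algebra anti-isomorphic to a commutative algebra is commutative. [folklore] -/
private theorem comm_of_algEquiv_mop (e : X ≃ₐ[F] Yᵐᵒᵖ) (hY : ∀ a b : Y, a * b = b * a) :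
    ∀ x y : X, x * y = y * x := by
  intro x y
  apply e.injective
  rw [map_mul, map_mul]
  induction hx : e x using MulOpposite.rec' with
  | h a =>
    induction hy : e y using MulOpposite.rec' with
    | h b => rw [← MulOpposite.op_mul, ← MulOpposite.op_mul, hY]

end Anti

/-! ## §1 The dictionary `S ↦ S♯ = (Sᵒᵖ)^* ⊆ End_ℚ H¹(A(ℂ); ℚ)` -/

section Dictionary

variable (A : AbelianVariety ℂ)

/-- `End⁰(A)` is finite-dimensional over `ℚ` (Mumford §19 Cor. 1–2 of Thm. 3; the tree's theorem on the `Algebra.toModule`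
structure). [cite: MumfordAV1970, §19 Cor. 1–2 of Thm. 3] -/
private theorem finiteDimensional_endAlgebra' (B : AbelianVariety ℂ) :
    @FiniteDimensional ℚ B.endAlgebra _ Ring.toAddCommGroup Algebra.toModule :=
  AbelianVariety.finiteDimensional_endAlgebra_holds B

/-- `S♯ = (Sᵒᵖ)^*` is anti-isomorphic to `S` (`f ↦ f^*` is injective and reverses products). [cite: MumfordAV1970, §19 Thm. 3] -/
private theorem nonempty_algEquiv_sharp (S : Subalgebra ℚ A.endAlgebra) :
    Nonempty (↥((Subalgebra.op S).map (bettiRepOp A)) ≃ₐ[ℚ] (↥S)ᵐᵒᵖ) :=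
  ⟨(Subalgebra.equivMapOfInjective (Subalgebra.op S) (bettiRepOp A) bettiRepOp_injective).symm.trans
    (Subalgebra.mopAlgEquivOp S).symm⟩

/-- Membership in `S♯`. [folklore] -/
private theorem mem_sharp_iff (S : Subalgebra ℚ A.endAlgebra) {y : Module.End ℚ (bettiCohomology A.X 1)} :
    y ∈ (Subalgebra.op S).map (bettiRepOp A) ↔ ∃ x ∈ S, bettiRepOp A (MulOpposite.op x) = y := by
  rw [Subalgebra.mem_map]
  constructor
  · rintro ⟨z, hz, rfl⟩
    exact ⟨MulOpposite.unop z, Subalgebra.mem_op.1 hz, by rw [MulOpposite.op_unop]⟩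
  · rintro ⟨x, hx, rfl⟩
    exact ⟨MulOpposite.op x, Subalgebra.mem_op.2 (by rwa [MulOpposite.unop_op]), rfl⟩

/-- `x^*` and `t^*` commute iff `x` and `t` do. [folklore] -/
private theorem bettiRepOp_commute_iff {x t : A.endAlgebra} :
    bettiRepOp A (MulOpposite.op t) * bettiRepOp A (MulOpposite.op x) =
        bettiRepOp A (MulOpposite.op x) * bettiRepOp A (MulOpposite.op t) ↔ t * x = x * t := by
  rw [← map_mul, ← map_mul, ← MulOpposite.op_mul, ← MulOpposite.op_mul]
  constructor
  · intro h
    exact (MulOpposite.op_injective (bettiRepOp_injective h)).symm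
  · intro h
    rw [h]

/-- The dictionary respects commutants: `S♯ ⊆ C_B(T♯)` iff `S ⊆ C(T)`. [folklore] -/
private theorem sharp_le_centralizer_sharp_iff (S T : Subalgebra ℚ A.endAlgebra) :
    (Subalgebra.op S).map (bettiRepOp A) ≤
        Subalgebra.centralizer ℚ (((Subalgebra.op T).map (bettiRepOp A) : Set (Module.End ℚ (bettiCohomology A.X 1)))) ↔
      S ≤ Subalgebra.centralizer ℚ (T : Set A.endAlgebra) := by
  constructor
  · intro h x hx
    rw [Subalgebra.mem_centralizer_iff]
    intro t ht
    have hx' : bettiRepOp A (MulOpposite.op x) ∈ (Subalgebra.op S).map (bettiRepOp A) :=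
      (mem_sharp_iff A S).2 ⟨x, hx, rfl⟩
    have h' := (Subalgebra.mem_centralizer_iff ℚ).1 (h hx') _ ((mem_sharp_iff A T).2 ⟨t, ht, rfl⟩)
    exact (bettiRepOp_commute_iff A).1 h'
  · intro h y hy
    obtain ⟨x, hx, rfl⟩ := (mem_sharp_iff A S).1 hy
    rw [Subalgebra.mem_centralizer_iff]
    intro g hg
    obtain ⟨t, ht, rfl⟩ := (mem_sharp_iff A T).1 hg
    exact (bettiRepOp_commute_iff A).2 ((Subalgebra.mem_centralizer_iff ℚ).1 (h hx) t ht)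

/-- The dictionary respects commutants inside `End⁰(A)`: `(C(T))♯ = End⁰(A)♯ ⊓ C_B(T♯)`. [folklore] -/
private theorem sharp_centralizer_eq (T : Subalgebra ℚ A.endAlgebra) :
    (Subalgebra.op (Subalgebra.centralizer ℚ (T : Set A.endAlgebra))).map (bettiRepOp A) =
      (bettiRepOp A).range ⊓
        Subalgebra.centralizer ℚ (((Subalgebra.op T).map (bettiRepOp A) : Set (Module.End ℚ (bettiCohomology A.X 1)))) := by
  apply le_antisymm
  · refine le_inf ?_ ((sharp_le_centralizer_sharp_iff A _ T).2 le_rfl)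
    rintro y hy
    obtain ⟨x, -, rfl⟩ := (mem_sharp_iff A _).1 hy
    exact ⟨_, rfl⟩
  · rintro y ⟨hy1, hy⟩
    obtain ⟨z, rfl⟩ := (AlgHom.mem_range _).1 hy1
    refine (mem_sharp_iff A _).2 ⟨MulOpposite.unop z, ?_, by rw [MulOpposite.op_unop]⟩
    rw [Subalgebra.mem_centralizer_iff]
    intro t ht
    have h := (Subalgebra.mem_centralizer_iff ℚ).1 hy _ ((mem_sharp_iff A T).2 ⟨t, ht, rfl⟩)
    rw [← MulOpposite.op_unop z] at h
    exact (bettiRepOp_commute_iff A).1 h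

/-- `H¹(A(ℂ); ℚ) ≠ 0` as soon as `End⁰(A)` contains two distinct endomorphisms (e.g. a simple subalgebra), since
`f ↦ f^*` is faithful. [cite: MumfordAV1970, §19 Thm. 3] -/
private theorem nontrivial_bettiCohomology_of_nontrivial (S : Subalgebra ℚ A.endAlgebra) [Nontrivial S] :
    Nontrivial (bettiCohomology A.X 1) := by
  obtain ⟨x, y, hxy⟩ := exists_pair_ne ↥S
  by_contra h
  haveI : Subsingleton (bettiCohomology A.X 1) := not_nontrivial_iff_subsingleton.1 h
  apply hxy
  have h1 : bettiRepOp A (MulOpposite.op (x : A.endAlgebra)) = bettiRepOp A (MulOpposite.op (y : A.endAlgebra)) :=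
    LinearMap.ext fun v => Subsingleton.elim _ _
  exact Subtype.ext (MulOpposite.op_injective (bettiRepOp_injective h1))

/-- `End_ℚ(V)` is simple for `V ≠ 0`. [folklore] -/
private theorem isSimpleRing_moduleEnd' {V : Type v} [AddCommGroup V] [Module ℚ V] [FiniteDimensional ℚ V]
    [Nontrivial V] : IsSimpleRing (Module.End ℚ V) := by
  have hn : 0 < finrank ℚ V := finrank_pos
  haveI : Nonempty (Fin (finrank ℚ V)) := ⟨⟨0, hn⟩⟩
  exact IsSimpleRing.of_ringEquiv (LinearMap.toMatrixAlgEquiv (Module.finBasis ℚ V)).symm.toRingEquiv inferInstance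

/-- A commutative semisimple subalgebra is reduced. [folklore] -/
private theorem isReduced_of_isSemisimpleRing_of_comm' {R : Type*} [CommRing R] {B : Type*} [Ring B] [Algebra R B]
    (S : Subalgebra R B) [IsSemisimpleRing S] (hcomm : ∀ x ∈ S, ∀ y ∈ S, x * y = y * x) : IsReduced S := by
  haveI : IsMulCommutative S := ⟨⟨fun a b => Subtype.ext (hcomm a a.2 b b.2)⟩⟩
  refine ⟨fun x hx => ?_⟩
  obtain ⟨n, eq⟩ := hx
  open scoped IsMulCommutative in
  exact (IsSemisimpleRing.jacobson_eq_bot ↥S).le <| Ideal.mem_sInf.mpr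
    fun I hI => (Ideal.isMaximal_def.mpr hI).isPrime.mem_of_pow_mem n (eq ▸ I.zero_mem)

end Dictionary

/-! ## §2 The bound: `d · dim_ℚ R ≤ 2 dim A` for every étale `R ⊆ End⁰_L(A)` -/

section Bound

variable (A : AbelianVariety ℂ) (L : Subalgebra ℚ A.endAlgebra) [IsSimpleRing L] {d : ℕ}

/-- **MILNE CM EX. 3.10 (a), first clause: «for any semisimple commutative `ℚ`-subalgebra `R` of `End⁰_L(A)`,
`dim_ℚ R ≤ 2 dim A / d`».**  For a simple `L ⊆ End⁰(A)` of degree `d` over its centre and every commutative reduced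
`R ⊆ End⁰(A)` commuting with `L`: `d · dim_ℚ R ≤ 2 dim A` (FILE 1's `d·[C_B(L♯):ℚ]_red = dim H¹ = 2 dim A` in
`B = End_ℚ H¹(A(ℂ); ℚ)`). [cite: MilneCM2006, Ch. I §3 Exercise 3.10 (a) (p. 29)] [cite: Voight2021, §7.7 Prop. 7.7.8] -/
theorem mul_finrank_le_two_mul_dim_of_le_centralizer (hd : finrank ℚ L = d ^ 2 * finrank ℚ ↥(Subalgebra.center ℚ ↥L))
    (R : Subalgebra ℚ A.endAlgebra) (hRcomm : ∀ x ∈ R, ∀ y ∈ R, x * y = y * x) [IsReduced R]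
    (hRL : R ≤ Subalgebra.centralizer ℚ (L : Set A.endAlgebra)) : d * finrank ℚ R ≤ 2 * A.dim := by
  haveI := finiteDimensional_endAlgebra' A
  haveI : FiniteDimensional ℚ (bettiCohomology A.X 1) := finite_bettiCohomology_one A
  haveI : Nontrivial (bettiCohomology A.X 1) := nontrivial_bettiCohomology_of_nontrivial A L
  haveI : IsSimpleRing (Module.End ℚ (bettiCohomology A.X 1)) := isSimpleRing_moduleEnd'
  have hn : finrank ℚ (Module.End ℚ (bettiCohomology A.X 1)) = (2 * A.dim) ^ 2 := by
    rw [Module.finrank_linearMap, finrank_bettiCohomology_one, sq]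
  obtain ⟨eL⟩ := nonempty_algEquiv_sharp A L
  obtain ⟨eR⟩ := nonempty_algEquiv_sharp A R
  haveI : IsSimpleRing ↥((Subalgebra.op L).map (bettiRepOp A)) := isSimpleRing_of_algEquiv_mop eL
  haveI : IsReduced ↥((Subalgebra.op R).map (bettiRepOp A)) := isReduced_of_algEquiv_mop eR
  have hd' : finrank ℚ ↥((Subalgebra.op L).map (bettiRepOp A)) =
      d ^ 2 * finrank ℚ ↥(Subalgebra.center ℚ ↥((Subalgebra.op L).map (bettiRepOp A))) := by
    rw [finrank_eq_of_algEquiv_mop eL, finrank_center_eq_of_algEquiv_mop eL, hd]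
  have hR'comm : ∀ x ∈ (Subalgebra.op R).map (bettiRepOp A), ∀ y ∈ (Subalgebra.op R).map (bettiRepOp A),
      x * y = y * x := fun x hx y hy ↦
    congrArg Subtype.val (comm_of_algEquiv_mop eR (fun a b => Subtype.ext (hRcomm a a.2 b b.2)) ⟨x, hx⟩ ⟨y, hy⟩)
  have h := mul_finrank_le_of_le_centralizer hn ((Subalgebra.op L).map (bettiRepOp A)) hd'
    ((Subalgebra.op R).map (bettiRepOp A)) hR'comm ((sharp_le_centralizer_sharp_iff A R L).2 hRL)
  rwa [finrank_eq_of_algEquiv_mop eR] at h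

/-- **The relative Prop. 3.1: `d · [End⁰_L(A) : ℚ]_red ≤ 2 dim A`.** [cite: MilneCM2006, Ch. I §3 Exercise 3.10 (a) (p. 29), Prop. 3.1 (p. 27)] -/
theorem mul_reducedDegree_centralizer_le_two_mul_dim (hd : finrank ℚ L = d ^ 2 * finrank ℚ ↥(Subalgebra.center ℚ ↥L)) :
    d * reducedDegree ℚ ↥(Subalgebra.centralizer ℚ (L : Set A.endAlgebra)) ≤ 2 * A.dim := by
  haveI := finiteDimensional_endAlgebra' A
  set T : Subalgebra ℚ A.endAlgebra := Subalgebra.centralizer ℚ (L : Set A.endAlgebra) with hTdef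
  obtain ⟨R', hR'comm, hR'red, hR'dim⟩ := exists_finrank_eq_reducedDegree (F := ℚ) (B := ↥T)
  haveI := hR'red
  let ψ := Subalgebra.equivMapOfInjective R' T.val Subtype.val_injective
  haveI : IsReduced ↥(R'.map T.val) := isReduced_of_injective ψ.symm ψ.symm.injective
  have h := mul_finrank_le_two_mul_dim_of_le_centralizer A L hd (R'.map T.val)
    (by rintro _ ⟨a, ha, rfl⟩ _ ⟨b, hb, rfl⟩; rw [← map_mul, ← map_mul, hR'comm a ha b hb])
    (by rintro _ ⟨x, -, rfl⟩; exact x.2)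
  rwa [← ψ.toLinearEquiv.finrank_eq, hR'dim] at h

end Bound

/-! ## §3 CM ⟹ equality for some `R` -/

section CMImpliesEquality

variable {A : AbelianVariety ℂ} (L : Subalgebra ℚ A.endAlgebra) [IsSimpleRing L] {d : ℕ}

/-- **EX. 3.10 (a): «equality holds for some `R` if `A` has complex multiplication», in reduced-degree form: CM ⟹
`d · [End⁰_L(A) : ℚ]_red = 2 dim A`.**  In `B = End_ℚ H¹`: the commutant `Z` of `End⁰(A)♯` is semisimple (bicommutant
theory) and commutative (Prop. 3.3 (c)), `L♯ ⊆ C_B(Z)`, and FILE 1 (B2) gives `d·[C_B(Z ∪ L♯)]_red = 2 dim A`, where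
`C_B(Z ∪ L♯) = End⁰(A)♯ ⊓ C_B(L♯) = (End⁰_L(A))♯` by the bicommutant theorem.
[cite: MilneCM2006, Ch. I §3 Exercise 3.10 (a) (p. 29), Prop. 3.3 (p. 27)] [cite: BourbakiAlgebreVIII2012, VIII §14 n°7 Cor. 1 (p. A VIII.260)] -/
theorem mul_reducedDegree_centralizer_eq_two_mul_dim_of_isOfCMType (h : IsOfCMType A)
    (hd : finrank ℚ L = d ^ 2 * finrank ℚ ↥(Subalgebra.center ℚ ↥L)) :
    d * reducedDegree ℚ ↥(Subalgebra.centralizer ℚ (L : Set A.endAlgebra)) = 2 * A.dim := by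
  haveI := finiteDimensional_endAlgebra' A
  haveI : FiniteDimensional ℚ (bettiCohomology A.X 1) := finite_bettiCohomology_one A
  haveI : Nontrivial (bettiCohomology A.X 1) := nontrivial_bettiCohomology_of_nontrivial A L
  haveI : IsSimpleRing (Module.End ℚ (bettiCohomology A.X 1)) := isSimpleRing_moduleEnd'
  have hn : finrank ℚ (Module.End ℚ (bettiCohomology A.X 1)) = (2 * A.dim) ^ 2 := by
    rw [Module.finrank_linearMap, finrank_bettiCohomology_one, sq]
  apply le_antisymm (mul_reducedDegree_centralizer_le_two_mul_dim A L hd)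
  -- `End⁰(A)♯ = range (f ↦ f^*)` is semisimple
  haveI : IsSemisimpleRing A.endAlgebra := AbelianVariety.isSemisimpleRing_endAlgebra_of_isAlgClosed A
  set E' : Subalgebra ℚ (Module.End ℚ (bettiCohomology A.X 1)) := (bettiRepOp A).range with hE'def
  haveI : IsSemisimpleRing ↥E' := (AlgEquiv.ofInjective (bettiRepOp A) bettiRepOp_injective).toRingEquiv.isSemisimpleRing
  have hE'coe : (E' : Set (Module.End ℚ (bettiCohomology A.X 1))) = Set.range (bettiRepOp A) := AlgHom.coe_range _
  -- its commutant `Z`: semisimple, commutative (Prop. 3.3 (c)), hence reduced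
  set Z : Subalgebra ℚ (Module.End ℚ (bettiCohomology A.X 1)) :=
    Subalgebra.centralizer ℚ (E' : Set (Module.End ℚ (bettiCohomology A.X 1))) with hZdef
  haveI : IsSemisimpleRing ↥Z := isSemisimpleRing_centralizer_of_isSemisimpleRing E'
  have hZcomm : ∀ x ∈ Z, ∀ y ∈ Z, x * y = y * x := by
    rw [hZdef, hE'coe]
    exact (isOfCMType_iff_centralizer_comm A).1 h
  haveI : IsReduced ↥Z := isReduced_of_isSemisimpleRing_of_comm' Z hZcomm
  -- `L♯`
  obtain ⟨eL⟩ := nonempty_algEquiv_sharp A L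
  haveI : IsSimpleRing ↥((Subalgebra.op L).map (bettiRepOp A)) := isSimpleRing_of_algEquiv_mop eL
  have hd' : finrank ℚ ↥((Subalgebra.op L).map (bettiRepOp A)) =
      d ^ 2 * finrank ℚ ↥(Subalgebra.center ℚ ↥((Subalgebra.op L).map (bettiRepOp A))) := by
    rw [finrank_eq_of_algEquiv_mop eL, finrank_center_eq_of_algEquiv_mop eL, hd]
  have hLE' : (Subalgebra.op L).map (bettiRepOp A) ≤ E' := by
    rintro y hy
    obtain ⟨x, -, rfl⟩ := (mem_sharp_iff A L).1 hy
    exact ⟨_, rfl⟩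
  have hLZ : (Subalgebra.op L).map (bettiRepOp A) ≤
      Subalgebra.centralizer ℚ (Z : Set (Module.End ℚ (bettiCohomology A.X 1))) := fun y hy ↦ by
    rw [Subalgebra.mem_centralizer_iff]
    intro z hz
    exact ((Subalgebra.mem_centralizer_iff ℚ).1 hz y (hLE' hy)).symm
  -- FILE 1 (B2)
  have hB2 := mul_reducedDegree_centralizer_union_eq hn Z hZcomm ((Subalgebra.op L).map (bettiRepOp A)) hLZ hd'
  -- `C_B(Z ∪ L♯) = E' ⊓ C_B(L♯) = (C(L))♯ ≃ C(L)ᵐᵒᵖ`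
  have hZZ : Subalgebra.centralizer ℚ (Z : Set (Module.End ℚ (bettiCohomology A.X 1))) = E' :=
    centralizer_centralizer_eq_of_isSemisimpleRing E'
  have heq : Subalgebra.centralizer ℚ ((Z : Set (Module.End ℚ (bettiCohomology A.X 1))) ∪
      ((Subalgebra.op L).map (bettiRepOp A) : Set (Module.End ℚ (bettiCohomology A.X 1)))) =
      (Subalgebra.op (Subalgebra.centralizer ℚ (L : Set A.endAlgebra))).map (bettiRepOp A) := by
    rw [sharp_centralizer_eq A L, ← hE'def, ← hZZ]
    ext x
    rw [Algebra.mem_inf, Subalgebra.mem_centralizer_iff, Subalgebra.mem_centralizer_iff,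
      Subalgebra.mem_centralizer_iff]
    constructor
    · intro hx
      exact ⟨fun g hg => hx g (Set.mem_union_left _ hg), fun g hg => hx g (Set.mem_union_right _ hg)⟩
    · rintro ⟨h1, h2⟩ g (hg | hg)
      · exact h1 g hg
      · exact h2 g hg
  obtain ⟨eC⟩ := nonempty_algEquiv_sharp A (Subalgebra.centralizer ℚ (L : Set A.endAlgebra))
  have hred : reducedDegree ℚ ↥(Subalgebra.centralizer ℚ ((Z : Set (Module.End ℚ (bettiCohomology A.X 1))) ∪
      ((Subalgebra.op L).map (bettiRepOp A) : Set (Module.End ℚ (bettiCohomology A.X 1))))) =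
      reducedDegree ℚ ↥(Subalgebra.centralizer ℚ (L : Set A.endAlgebra)) := by
    rw [reducedDegree_eq_of_algEquiv (Subalgebra.equivOfEq _ _ heq), reducedDegree_eq_of_algEquiv eC,
      reducedDegree_mulOpposite]
  rw [← hred, hB2]

/-- **EX. 3.10 (a): «equality holds for some `R` if `A` has complex multiplication»**: if `A` is of CM-type then
`End⁰_L(A)` contains a commutative reduced `R` with `d · dim_ℚ R = 2 dim A`. [cite: MilneCM2006, Ch. I §3 Exercise 3.10 (a) (p. 29)] -/
theorem exists_le_centralizer_mul_finrank_eq_two_mul_dim_of_isOfCMType (h : IsOfCMType A)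
    (hd : finrank ℚ L = d ^ 2 * finrank ℚ ↥(Subalgebra.center ℚ ↥L)) :
    ∃ R : Subalgebra ℚ A.endAlgebra, R ≤ Subalgebra.centralizer ℚ (L : Set A.endAlgebra) ∧
      (∀ x ∈ R, ∀ y ∈ R, x * y = y * x) ∧ IsReduced R ∧ d * finrank ℚ R = 2 * A.dim := by
  haveI := finiteDimensional_endAlgebra' A
  set T : Subalgebra ℚ A.endAlgebra := Subalgebra.centralizer ℚ (L : Set A.endAlgebra) with hTdef
  have hT := mul_reducedDegree_centralizer_eq_two_mul_dim_of_isOfCMType L h hd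
  obtain ⟨R', hR'comm, hR'red, hR'dim⟩ := exists_finrank_eq_reducedDegree (F := ℚ) (B := ↥T)
  haveI := hR'red
  let ψ := Subalgebra.equivMapOfInjective R' T.val Subtype.val_injective
  refine ⟨R'.map T.val, ?_, ?_, isReduced_of_injective ψ.symm ψ.symm.injective, ?_⟩
  · rintro _ ⟨x, -, rfl⟩
    exact x.2
  · rintro _ ⟨a, ha, rfl⟩ _ ⟨b, hb, rfl⟩
    rw [← map_mul, ← map_mul, hR'comm a ha b hb]
  · rw [← hT, ← hR'dim]
    congr 1
    exact ψ.symm.toLinearEquiv.finrank_eq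

end CMImpliesEquality

/-! ## §4 Equality for some `R` ⟹ CM -/

section EqualityImpliesCM

variable (A : AbelianVariety ℂ) (L : Subalgebra ℚ A.endAlgebra) [IsSimpleRing L] {d : ℕ}

/-- **EX. 3.10 (a): «equality holds for some `R` ONLY IF `A` has complex multiplication».**  A commutative reduced
`R ⊆ End⁰_L(A)` with `d · dim_ℚ R = 2 dim A` gives `C_B(R♯ ∪ L♯) = R♯` in `B = End_ℚ H¹` (FILE 1 (B3), Bourbaki VIII
§14 n°7 Prop. 4 a)), so the commutant of `End⁰(A)♯ ⊇ R♯ ∪ L♯` is commutative: Prop. 3.3 (c) ⟹ (a) (A3-G140).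
[cite: MilneCM2006, Ch. I §3 Exercise 3.10 (a) (p. 29), Prop. 3.3 (p. 27)] [cite: BourbakiAlgebreVIII2012, VIII §14 n°7 Prop. 4 a) (p. A VIII.260)] -/
theorem isOfCMType_of_mul_finrank_eq_two_mul_dim (hd : finrank ℚ L = d ^ 2 * finrank ℚ ↥(Subalgebra.center ℚ ↥L))
    (R : Subalgebra ℚ A.endAlgebra) (hRcomm : ∀ x ∈ R, ∀ y ∈ R, x * y = y * x) [IsReduced R]
    (hRL : R ≤ Subalgebra.centralizer ℚ (L : Set A.endAlgebra)) (hR : d * finrank ℚ R = 2 * A.dim) :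
    IsOfCMType A := by
  haveI := finiteDimensional_endAlgebra' A
  haveI : FiniteDimensional ℚ (bettiCohomology A.X 1) := finite_bettiCohomology_one A
  haveI : Nontrivial (bettiCohomology A.X 1) := nontrivial_bettiCohomology_of_nontrivial A L
  haveI : IsSimpleRing (Module.End ℚ (bettiCohomology A.X 1)) := isSimpleRing_moduleEnd'
  have hn : finrank ℚ (Module.End ℚ (bettiCohomology A.X 1)) = (2 * A.dim) ^ 2 := by
    rw [Module.finrank_linearMap, finrank_bettiCohomology_one, sq]
  obtain ⟨eL⟩ := nonempty_algEquiv_sharp A L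
  obtain ⟨eR⟩ := nonempty_algEquiv_sharp A R
  haveI : IsSimpleRing ↥((Subalgebra.op L).map (bettiRepOp A)) := isSimpleRing_of_algEquiv_mop eL
  haveI : IsReduced ↥((Subalgebra.op R).map (bettiRepOp A)) := isReduced_of_algEquiv_mop eR
  have hd' : finrank ℚ ↥((Subalgebra.op L).map (bettiRepOp A)) =
      d ^ 2 * finrank ℚ ↥(Subalgebra.center ℚ ↥((Subalgebra.op L).map (bettiRepOp A))) := by
    rw [finrank_eq_of_algEquiv_mop eL, finrank_center_eq_of_algEquiv_mop eL, hd]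
  have hR'comm : ∀ x ∈ (Subalgebra.op R).map (bettiRepOp A), ∀ y ∈ (Subalgebra.op R).map (bettiRepOp A),
      x * y = y * x := fun x hx y hy ↦
    congrArg Subtype.val (comm_of_algEquiv_mop eR (fun a b => Subtype.ext (hRcomm a a.2 b b.2)) ⟨x, hx⟩ ⟨y, hy⟩)
  have hR' : d * finrank ℚ ↥((Subalgebra.op R).map (bettiRepOp A)) = 2 * A.dim := by
    rw [finrank_eq_of_algEquiv_mop eR, hR]
  have hLE : (Subalgebra.op L).map (bettiRepOp A) ≤ (bettiRepOp A).range := by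
    rintro y hy
    obtain ⟨x, -, rfl⟩ := (mem_sharp_iff A L).1 hy
    exact ⟨_, rfl⟩
  have hRE : (Subalgebra.op R).map (bettiRepOp A) ≤ (bettiRepOp A).range := by
    rintro y hy
    obtain ⟨x, -, rfl⟩ := (mem_sharp_iff A R).1 hy
    exact ⟨_, rfl⟩
  have h := (centralizer_comm_of_mul_finrank_eq hn ((Subalgebra.op L).map (bettiRepOp A)) hd'
    ((Subalgebra.op R).map (bettiRepOp A)) hR'comm ((sharp_le_centralizer_sharp_iff A R L).2 hRL) hR'
    (bettiRepOp A).range hLE hRE).2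
  rw [AlgHom.coe_range] at h
  exact (isOfCMType_iff_centralizer_comm A).2 h

end EqualityImpliesCM

/-! ## §5 Exercise 3.10 (a) as equivalences -/

section Iff

variable (A : AbelianVariety ℂ) (L : Subalgebra ℚ A.endAlgebra) [IsSimpleRing L] {d : ℕ}

/-- **MILNE CM EX. 3.10 (a) for complex abelian varieties**: for a simple `L ⊆ End⁰(A)` of degree `d` over its centre,
`End⁰_L(A)` contains a commutative reduced `R` with `d · dim_ℚ R = 2 dim A` («equality holds for some `R`») iff `A` has
complex multiplication. [cite: MilneCM2006, Ch. I §3 Exercise 3.10 (a) (p. 29)] -/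
theorem exists_mul_finrank_eq_two_mul_dim_iff_isOfCMType
    (hd : finrank ℚ L = d ^ 2 * finrank ℚ ↥(Subalgebra.center ℚ ↥L)) :
    (∃ R : Subalgebra ℚ A.endAlgebra, R ≤ Subalgebra.centralizer ℚ (L : Set A.endAlgebra) ∧
        (∀ x ∈ R, ∀ y ∈ R, x * y = y * x) ∧ IsReduced R ∧ d * finrank ℚ R = 2 * A.dim) ↔
      IsOfCMType A := by
  constructor
  · rintro ⟨R, hRL, hRcomm, hRred, hR⟩
    exact isOfCMType_of_mul_finrank_eq_two_mul_dim A L hd R hRcomm hRL hR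
  · exact fun h ↦ exists_le_centralizer_mul_finrank_eq_two_mul_dim_of_isOfCMType L h hd

/-- **The relative Def. 3.2: `d · [End⁰_L(A) : ℚ]_red = 2 dim A` iff `A` has complex multiplication.**
[cite: MilneCM2006, Ch. I §3 Exercise 3.10 (a) (p. 29), Def. 3.2 (p. 27)] -/
theorem mul_reducedDegree_centralizer_eq_two_mul_dim_iff_isOfCMType
    (hd : finrank ℚ L = d ^ 2 * finrank ℚ ↥(Subalgebra.center ℚ ↥L)) :
    d * reducedDegree ℚ ↥(Subalgebra.centralizer ℚ (L : Set A.endAlgebra)) = 2 * A.dim ↔ IsOfCMType A := by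
  refine ⟨fun h ↦ ?_, fun h ↦ mul_reducedDegree_centralizer_eq_two_mul_dim_of_isOfCMType L h hd⟩
  haveI := finiteDimensional_endAlgebra' A
  set T : Subalgebra ℚ A.endAlgebra := Subalgebra.centralizer ℚ (L : Set A.endAlgebra) with hTdef
  obtain ⟨R', hR'comm, hR'red, hR'dim⟩ := exists_finrank_eq_reducedDegree (F := ℚ) (B := ↥T)
  haveI := hR'red
  let ψ := Subalgebra.equivMapOfInjective R' T.val Subtype.val_injective
  haveI : IsReduced ↥(R'.map T.val) := isReduced_of_injective ψ.symm ψ.symm.injective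
  refine isOfCMType_of_mul_finrank_eq_two_mul_dim A L hd (R'.map T.val) ?_ ?_ ?_
  · rintro _ ⟨a, ha, rfl⟩ _ ⟨b, hb, rfl⟩
    rw [← map_mul, ← map_mul, hR'comm a ha b hb]
  · rintro _ ⟨x, -, rfl⟩
    exact x.2
  · rw [← h, ← hR'dim]
    congr 1
    exact ψ.symm.toLinearEquiv.finrank_eq

/-- **EX. 3.10 (a) with Def. 3.2 spelled out: `d · [End⁰_L(A) : ℚ]_red = 2 dim A` iff `[End⁰(A) : ℚ]_red = 2 dim A`.**
[cite: MilneCM2006, Ch. I §3 Exercise 3.10 (a) (p. 29), Def. 3.2 (p. 27)] -/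
theorem mul_reducedDegree_centralizer_eq_two_mul_dim_iff_reducedDegree_eq
    (hd : finrank ℚ L = d ^ 2 * finrank ℚ ↥(Subalgebra.center ℚ ↥L)) :
    d * reducedDegree ℚ ↥(Subalgebra.centralizer ℚ (L : Set A.endAlgebra)) = 2 * A.dim ↔
      reducedDegree ℚ A.endAlgebra = 2 * A.dim := by
  rw [mul_reducedDegree_centralizer_eq_two_mul_dim_iff_isOfCMType A L hd, isOfCMType_iff_reducedDegree_eq]

end Iff

/-! ## §6 Two special cases: a central simple `L`, and a subfield `L` (`d = 1`) -/

section Special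

variable (A : AbelianVariety ℂ) (L : Subalgebra ℚ A.endAlgebra) [IsSimpleRing L] {d : ℕ}

/-- **EX. 3.10 (a) for a CENTRAL simple `L ⊆ End⁰(A)`, `[L : ℚ] = d²`** (e.g. quaternion multiplication, `d = 2`:
«`A` has CM iff `End⁰_L(A)` contains an étale algebra of dimension `dim A`»): the bound and the equivalence.
[cite: MilneCM2006, Ch. I §3 Exercise 3.10 (a) (p. 29)] -/
theorem exists_mul_finrank_eq_two_mul_dim_iff_isOfCMType_of_isCentral [Algebra.IsCentral ℚ ↥L]
    (hd : finrank ℚ L = d ^ 2) :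
    (∀ R : Subalgebra ℚ A.endAlgebra, R ≤ Subalgebra.centralizer ℚ (L : Set A.endAlgebra) →
        (∀ x ∈ R, ∀ y ∈ R, x * y = y * x) → IsReduced R → d * finrank ℚ R ≤ 2 * A.dim) ∧
      ((∃ R : Subalgebra ℚ A.endAlgebra, R ≤ Subalgebra.centralizer ℚ (L : Set A.endAlgebra) ∧
          (∀ x ∈ R, ∀ y ∈ R, x * y = y * x) ∧ IsReduced R ∧ d * finrank ℚ R = 2 * A.dim) ↔ IsOfCMType A) := by
  have hd' : finrank ℚ L = d ^ 2 * finrank ℚ ↥(Subalgebra.center ℚ ↥L) := by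
    rw [hd, Algebra.IsCentral.center_eq_bot, Subalgebra.finrank_bot, mul_one]
  exact ⟨fun R hRL hRcomm _ ↦ mul_finrank_le_two_mul_dim_of_le_centralizer A L hd' R hRcomm hRL,
    exists_mul_finrank_eq_two_mul_dim_iff_isOfCMType A L hd'⟩

/-- **EX. 3.10 (a) for a SUBFIELD `L ⊆ End⁰(A)` (`d = 1`, `L` commutative simple, `Z(L) = L`)**: every étale `R`
commuting with `L` has `dim_ℚ R ≤ 2 dim A`, with equality for some `R` iff `A` has complex multiplication — consistent
with Prop. 3.3 (a) ⟺ (b) (the case `L = ℚ`). [cite: MilneCM2006, Ch. I §3 Exercise 3.10 (a) (p. 29), Prop. 3.3 (pp. 27–28)] -/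
theorem exists_finrank_eq_two_mul_dim_iff_isOfCMType_of_comm (hL : ∀ x y : ↥L, x * y = y * x) :
    (∀ R : Subalgebra ℚ A.endAlgebra, R ≤ Subalgebra.centralizer ℚ (L : Set A.endAlgebra) →
        (∀ x ∈ R, ∀ y ∈ R, x * y = y * x) → IsReduced R → finrank ℚ R ≤ 2 * A.dim) ∧
      ((∃ R : Subalgebra ℚ A.endAlgebra, R ≤ Subalgebra.centralizer ℚ (L : Set A.endAlgebra) ∧
          (∀ x ∈ R, ∀ y ∈ R, x * y = y * x) ∧ IsReduced R ∧ finrank ℚ R = 2 * A.dim) ↔ IsOfCMType A) := by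
  have hc : Subalgebra.center ℚ ↥L = ⊤ := eq_top_iff.2 fun x _ => Subalgebra.mem_center_iff.2 fun y => hL y x
  have hd' : finrank ℚ L = 1 ^ 2 * finrank ℚ ↥(Subalgebra.center ℚ ↥L) := by
    rw [one_pow, one_mul, hc]
    exact (Subalgebra.topEquiv (R := ℚ) (A := ↥L)).toLinearEquiv.finrank_eq.symm
  refine ⟨fun R hRL hRcomm _ ↦ ?_, ?_⟩
  · have h := mul_finrank_le_two_mul_dim_of_le_centralizer A L hd' R hRcomm hRL
    rwa [one_mul] at h
  · have h := exists_mul_finrank_eq_two_mul_dim_iff_isOfCMType A L hd'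
    simp only [one_mul] at h
    exact h

end Special

/-! ## §6 EXERCISE 3.10 (b) for an abelian variety: an `R` as in (a) STABLE UNDER A ROSATI INVOLUTION
(row A3-G147, generation 62; the torus-level twin is `NumberTheory/ComplexMultiplication/CMAlgebraTorusSimpleSubalgebraRosatiStable`) -/

section RosatiStable

/-- A subalgebra is reduced iff it contains no non-zero nilpotent element of the ambient algebra. [folklore] -/
private theorem isReduced_subalgebra_iff₆ {R : Type*} [CommSemiring R] {X : Type*} [Semiring X] [Algebra R X]
    (S : Subalgebra R X) : IsReduced S ↔ ∀ x ∈ S, IsNilpotent x → x = 0 := by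
  constructor
  · rintro h x hx ⟨n, hn⟩
    have h0 : (⟨x, hx⟩ : S) = 0 :=
      h.eq_zero _ ⟨n, Subtype.ext (by rw [SubmonoidClass.coe_pow, ZeroMemClass.coe_zero]; exact hn)⟩
    exact congrArg Subtype.val h0
  · intro h
    refine ⟨fun x hx => ?_⟩
    obtain ⟨n, hn⟩ := hx
    exact Subtype.ext (h x x.2 ⟨n, by rw [← SubmonoidClass.coe_pow, hn]; rfl⟩)

/-- A polarization of a weight-`n` Hodge structure is `(-1)ⁿ`-symmetric, in the shape `ψ(v, w) = ε · ψ(w, v)` used by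
FILE 2 of A3-G147 (the field `Polarization.flip_form`, elementwise). [cite: VoisinHodgeI2002, §7.1.2] -/
private theorem form_eq_eps_mul_form_swap {V : Type*} [AddCommGroup V] [Module ℚ V] {n : ℤ} {H : HodgeStructure V n}
    (ψ : H.Polarization) (v w : V) : ψ.form v w = (((n.negOnePow : ℤˣ) : ℤ) : ℚ) * ψ.form w v := by
  have h : ψ.form v w = ((n.negOnePow : ℤˣ) : ℤ) • ψ.form w v := LinearMap.congr_fun₂ ψ.flip_form w v
  rw [h, zsmul_eq_mul]

variable {A : AbelianVariety ℂ} (L : Subalgebra ℚ A.endAlgebra) [IsSimpleRing L] {d : ℕ}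

/-- ★★★ **MILNE CM EX. 3.10 (b) FOR AN ABELIAN VARIETY: «Let `′` be a Rosati involution on `End⁰(A)` stabilizing `L`;
show that, if `A` has complex multiplication, then there is an `R` as in (a) that is stabilized by `′`.»**  For
`A` of CM-type, a polarization `ψ` of `H¹(A(ℂ); ℚ)` with its Rosati involution `a ↦ a′` of `End⁰(A)` (the tree's
`AbelianVariety.rosati`: `(a′)^* = (a^*)†`, `†` the `ψ`-adjoint), and a simple `L ⊆ End⁰(A)` of degree `d` over its
centre with `L′ = L`: there is a commutative reduced `R ⊆ End⁰_L(A)` with `d · dim_ℚ R = 2 dim A` and `R′ = R`.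
PROOF (in `B = End_ℚ H¹`, `V = H¹(A(ℂ); ℚ)`): the commutant `Z` of `End⁰(A)♯` is commutative (Prop. 3.3 (c)) and
semisimple, hence reduced, and `†`-stable (as `End⁰(A)♯` is); `S = ℚ[L♯ ∪ Z]` is `†`-stable and semisimple, so `V` is a
semisimple `S`-module on which `S` acts by `ψ`-adjointable operators; FILE 2 of A3-G147 (Cimprič's Lemma 5 inside the
block algebra of an orthogonal decomposition of `V`) yields a `†`-stable commutative reduced `R ⊆ C_B(S) =
End⁰(A)♯ ⊓ C_B(L♯)` maximal commutative in `C_B(S)`; `Z ⊆ R` by maximality, so `R` is a maximal étale subalgebra of the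
SIMPLE `C_B(L♯)` and `d · dim R = d · [C_B(L♯)]_red = dim V = 2 dim A`; pull back along `a ↦ a^*`.
[cite: MilneCM2006, Ch. I §3 Exercise 3.10 (b) (p. 29)] [cite: Cimpric2008FormallyRealInvolutions, §2 Lemma 5]
[cite: Lange2023AbelianVarietiesComplex, §2.4.1 Prop. 2.4.2 (the Rosati involution is the adjoint for the Riemann form)] -/
theorem exists_rosati_stable_le_centralizer_mul_finrank_eq_two_mul_dim_of_isOfCMType
    (hHD : exists_isReal_hodgeModel) (hI : hodgePQ_independent_of_hodgeModel) [Module.Finite ℚ (bettiCohomology A.X 1)]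
    (ψ : (BettiUniverse.hodge hHD (AbelianVariety.isSmoothProjective_holds (A := A)) 1).Polarization)
    (h : IsOfCMType A) (hd : finrank ℚ L = d ^ 2 * finrank ℚ ↥(Subalgebra.center ℚ ↥L))
    (hLr : ∀ a ∈ L, AbelianVariety.rosati A hHD hI ψ a ∈ L) :
    ∃ R : Subalgebra ℚ A.endAlgebra, R ≤ Subalgebra.centralizer ℚ (L : Set A.endAlgebra) ∧
      (∀ x ∈ R, ∀ y ∈ R, x * y = y * x) ∧ IsReduced R ∧ d * finrank ℚ R = 2 * A.dim ∧
      ∀ a ∈ R, AbelianVariety.rosati A hHD hI ψ a ∈ R := by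
  haveI := finiteDimensional_endAlgebra' A
  haveI : Nontrivial (bettiCohomology A.X 1) := nontrivial_bettiCohomology_of_nontrivial A L
  haveI : IsSimpleRing (Module.End ℚ (bettiCohomology A.X 1)) := isSimpleRing_moduleEnd'
  haveI : IsSemisimpleRing A.endAlgebra := AbelianVariety.isSemisimpleRing_endAlgebra_of_isAlgClosed A
  -- `E' = End⁰(A)♯` is semisimple; its commutant `Z` is semisimple and commutative (CM, Prop. 3.3 (c)), hence reduced
  set E' : Subalgebra ℚ (Module.End ℚ (bettiCohomology A.X 1)) := (bettiRepOp A).range with hE'def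
  haveI : IsSemisimpleRing ↥E' := (AlgEquiv.ofInjective (bettiRepOp A) bettiRepOp_injective).toRingEquiv.isSemisimpleRing
  have hE'coe : (E' : Set (Module.End ℚ (bettiCohomology A.X 1))) = Set.range (bettiRepOp A) := AlgHom.coe_range _
  have hmemE' : ∀ {y : Module.End ℚ (bettiCohomology A.X 1)}, y ∈ E' ↔
      ∃ x : A.endAlgebra, bettiRepOp A (MulOpposite.op x) = y := by
    intro y
    constructor
    · intro hy
      obtain ⟨w, rfl⟩ := (AlgHom.mem_range _).1 hy
      exact ⟨MulOpposite.unop w, by rw [MulOpposite.op_unop]⟩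
    · rintro ⟨x, rfl⟩
      exact (AlgHom.mem_range _).2 ⟨_, rfl⟩
  set Z : Subalgebra ℚ (Module.End ℚ (bettiCohomology A.X 1)) :=
    Subalgebra.centralizer ℚ (E' : Set (Module.End ℚ (bettiCohomology A.X 1))) with hZdef
  haveI : IsSemisimpleRing ↥Z := isSemisimpleRing_centralizer_of_isSemisimpleRing E'
  have hZcomm : ∀ x ∈ Z, ∀ y ∈ Z, x * y = y * x := by
    rw [hZdef, hE'coe]
    exact (isOfCMType_iff_centralizer_comm A).1 h
  have hZred : IsReduced ↥Z := isReduced_of_isSemisimpleRing_of_comm' Z hZcomm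
  have hZZ : Subalgebra.centralizer ℚ (Z : Set (Module.End ℚ (bettiCohomology A.X 1))) = E' :=
    centralizer_centralizer_eq_of_isSemisimpleRing E'
  -- `L' = L♯`: simple of degree `d` over its centre, inside `E'`, commuting with `Z`
  set L' : Subalgebra ℚ (Module.End ℚ (bettiCohomology A.X 1)) := (Subalgebra.op L).map (bettiRepOp A) with hL'def
  obtain ⟨eL⟩ := nonempty_algEquiv_sharp A L
  haveI : IsSimpleRing ↥L' := isSimpleRing_of_algEquiv_mop eL
  have hd' : finrank ℚ ↥L' = d ^ 2 * finrank ℚ ↥(Subalgebra.center ℚ ↥L') := by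
    rw [finrank_eq_of_algEquiv_mop eL, finrank_center_eq_of_algEquiv_mop eL, hd]
  have hLE' : L' ≤ E' := by
    intro y hy
    obtain ⟨x, -, rfl⟩ := (mem_sharp_iff A L).1 hy
    exact ⟨_, rfl⟩
  have hLZ : ∀ l ∈ L', ∀ z ∈ Z, l * z = z * l := fun l hl z hz ↦
    (Subalgebra.mem_centralizer_iff ℚ).1 hz l (hLE' hl)
  -- the `ψ`-adjoint `†` as a `ℚ`-linear anti-involution `σ` of `B = End_ℚ H¹`; `(a′)^* = σ (a^*)`
  let σ : Module.End ℚ (bettiCohomology A.X 1) →ₗ[ℚ] Module.End ℚ (bettiCohomology A.X 1) :=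
    { toFun := ψ.adjoint, map_add' := ψ.adjoint_add, map_smul' := ψ.adjoint_smul }
  have hσ : ∀ x, σ x = ψ.adjoint x := fun _ ↦ rfl
  have hσmul : ∀ x y, σ (x * y) = σ y * σ x := fun x y ↦ ψ.adjoint_mul x y
  have hσσ : ∀ x, σ (σ x) = x := fun x ↦ ψ.adjoint_adjoint x
  have hρr : ∀ a : A.endAlgebra,
      bettiRepOp A (MulOpposite.op (AbelianVariety.rosati A hHD hI ψ a)) = σ (bettiRepOp A (MulOpposite.op a)) := by
    intro a
    rw [hσ, bettiRepOp_apply, bettiRepOp_apply, MulOpposite.unop_op, MulOpposite.unop_op]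
    exact AbelianVariety.unop_bettiRep_rosati hHD hI ψ a
  have hE'σ : ∀ y ∈ E', σ y ∈ E' := by
    intro y hy
    obtain ⟨x, rfl⟩ := hmemE'.1 hy
    exact hmemE'.2 ⟨AbelianVariety.rosati A hHD hI ψ x, hρr x⟩
  have hZσ : ∀ z ∈ Z, σ z ∈ Z := AntiInvolution.centralizer_stable σ hσmul hσσ hE'σ
  have hL'σ : ∀ y ∈ L', σ y ∈ L' := by
    intro y hy
    obtain ⟨x, hx, rfl⟩ := (mem_sharp_iff A L).1 hy
    exact (mem_sharp_iff A L).2 ⟨AbelianVariety.rosati A hHD hI ψ x, hLr x hx, hρr x⟩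
  -- `S = ℚ[L' ∪ Z]`: `σ`-stable and semisimple
  set S : Subalgebra ℚ (Module.End ℚ (bettiCohomology A.X 1)) :=
    Algebra.adjoin ℚ ((L' : Set (Module.End ℚ (bettiCohomology A.X 1))) ∪
      (Z : Set (Module.End ℚ (bettiCohomology A.X 1)))) with hSdef
  have hLS : L' ≤ S := fun x hx ↦ Algebra.subset_adjoin (Or.inl hx)
  have hZS : Z ≤ S := fun x hx ↦ Algebra.subset_adjoin (Or.inr hx)
  have hSσ : ∀ a ∈ S, σ a ∈ S := by
    refine AntiInvolution.adjoin_stable σ hσmul hσσ ?_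
    rintro x (hx | hx)
    · exact Algebra.subset_adjoin (Or.inl (hL'σ x hx))
    · exact Algebra.subset_adjoin (Or.inr (hZσ x hx))
  haveI : IsSemisimpleRing ↥L' := by
    haveI : IsArtinianRing ↥L' := IsArtinianRing.of_finite ℚ _
    infer_instance
  haveI : IsSemisimpleRing ↥S :=
    Literature.NumberTheory.ComplexMultiplication.isSemisimpleRing_adjoin_union_of_comm_isReduced L' Z hZcomm hLZ
  have hcommS : ∀ y : Module.End ℚ (bettiCohomology A.X 1), (∀ l ∈ L', y * l = l * y) →
      (∀ z ∈ Z, y * z = z * y) → ∀ c ∈ S, y * c = c * y := by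
    intro y hyL hyZ c hc
    refine (Algebra.commute_of_mem_adjoin_of_forall_mem_commute hc ?_).eq
    rintro b (hb | hb)
    · exact hyL b hb
    · exact hyZ b hb
  -- FILE 2 of A3-G147 on `V = H¹(A(ℂ); ℚ)` as an `S`-module with the non-degenerate `(-1)ⁿ`-symmetric form `ψ`, `S`
  -- acting by `σ`-adjointable operators: a `σ`-stable commutative reduced `R ⊆ End_S(V) = C_B(S)`, maximal commutative
  obtain ⟨R, hRS, hRcomm, hRred, hRmax, hRadj⟩ :=
    Literature.RingTheory.SimpleModule.Commutant.exists_subalgebra_comm_reduced_maximal_adjoint_stable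
      (F := ℚ) (S := ↥S) (V := bettiCohomology A.X 1) ψ.form two_ne_zero ψ.nondegenerate
      (form_eq_eps_mul_form_swap ψ)
      (fun s ↦ ⟨⟨σ s, hSσ _ s.2⟩, fun v w ↦ by
        show ψ.form ((s : Module.End ℚ (bettiCohomology A.X 1)) v) w =
          ψ.form v (ψ.adjoint (s : Module.End ℚ (bettiCohomology A.X 1)) w)
        exact ψ.isAdjointPair_adjoint _ v w⟩)
  have hRS' : ∀ x ∈ R, ∀ c ∈ S, x * c = c * x := fun x hx c hc ↦ LinearMap.ext fun v ↦ by
    show x (c v) = c (x v)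
    exact hRS x hx ⟨c, hc⟩ v
  have hRmax' : ∀ f : Module.End ℚ (bettiCohomology A.X 1), (∀ c ∈ S, f * c = c * f) →
      (∀ x ∈ R, f * x = x * f) → f ∈ R := fun f hf hfR ↦
    hRmax f (fun c v ↦ by
      show f ((c : Module.End ℚ (bettiCohomology A.X 1)) v) = (c : Module.End ℚ (bettiCohomology A.X 1)) (f v)
      rw [← Module.End.mul_apply, hf c c.2, Module.End.mul_apply]) hfR
  have hRσ : ∀ x ∈ R, σ x ∈ R := by
    intro x hx
    obtain ⟨y, hy, hxy⟩ := hRadj x hx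
    have hyx : y = ψ.adjoint x := ψ.eq_adjoint_of_isAdjointPair hxy
    rw [hσ, ← hyx]
    exact hy
  -- `R ⊆ C_B(S) ⊆ C_B(Z) = E'`; `Z ⊆ R` by maximality; an element of `C_B(L')` commuting with `R` lies in `R`
  have hRE' : R ≤ E' := by
    intro x hx
    rw [← hZZ, Subalgebra.mem_centralizer_iff]
    exact fun z hz ↦ (hRS' x hx z (hZS hz)).symm
  have hZR : Z ≤ R := fun z hz ↦
    hRmax' z (hcommS z (fun l hl ↦ (hLZ l hl z hz).symm) (fun z' hz' ↦ hZcomm z hz z' hz'))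
      (fun t ht ↦ (hRS' t ht z (hZS hz)).symm)
  have hmaxR : ∀ y ∈ Subalgebra.centralizer ℚ (L' : Set (Module.End ℚ (bettiCohomology A.X 1))),
      (∀ t ∈ R, y * t = t * y) → y ∈ R := fun y hy hyT ↦
    hRmax' y (hcommS y (fun l hl ↦ ((Subalgebra.mem_centralizer_iff ℚ).1 hy l hl).symm)
      (fun z hz ↦ hyT z (hZR hz))) hyT
  -- DIMENSION: `R` is a maximal étale subalgebra of the SIMPLE `C_B(L')`, so `d · dim R = d · [C_B(L')]_red = dim V`
  have hRdim : d * finrank ℚ R = 2 * A.dim := by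
    set C : Subalgebra ℚ (Module.End ℚ (bettiCohomology A.X 1)) :=
      Subalgebra.centralizer ℚ (L' : Set (Module.End ℚ (bettiCohomology A.X 1))) with hCdef
    haveI : IsSimpleRing ↥C := isSimpleRing_centralizer L'
    have hRC : R ≤ C := fun y hy ↦ by
      rw [hCdef, Subalgebra.mem_centralizer_iff]
      exact fun l hl ↦ (hRS' y hy l (hLS hl)).symm
    set R' : Subalgebra ℚ ↥C := R.comap C.val with hR'def
    have hmem : ∀ x : ↥C, x ∈ R' ↔ (x : Module.End ℚ (bettiCohomology A.X 1)) ∈ R := fun x ↦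
      Subalgebra.mem_comap _ _ _
    have hR'comm : ∀ x ∈ R', ∀ y ∈ R', x * y = y * x := fun x hx y hy ↦
      Subtype.ext (hRcomm _ ((hmem x).1 hx) _ ((hmem y).1 hy))
    have hRred' := (isReduced_subalgebra_iff₆ R).1 hRred
    have hR'red : IsReduced ↥R' := by
      rw [isReduced_subalgebra_iff₆]
      intro x hx hn'
      obtain ⟨m, hm⟩ := hn'
      exact Subtype.ext (hRred' _ ((hmem x).1 hx) ⟨m, by rw [← SubmonoidClass.coe_pow, hm]; rfl⟩)
    have hdim : finrank ℚ ↥R' = finrank ℚ R := by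
      let φ : ↥R' →ₗ[ℚ] ↥R :=
        { toFun := fun x => ⟨((x : ↥C) : Module.End ℚ (bettiCohomology A.X 1)), (hmem x).1 x.2⟩
          map_add' := fun x y => rfl
          map_smul' := fun r x => rfl }
      have hφ : Function.Bijective φ := by
        constructor
        · intro x y hxy
          exact Subtype.ext (Subtype.ext (congrArg (fun z : ↥R => (z : Module.End ℚ (bettiCohomology A.X 1))) hxy))
        · intro y
          exact ⟨⟨⟨(y : Module.End ℚ (bettiCohomology A.X 1)), hRC y.2⟩, (hmem _).2 y.2⟩, rfl⟩
      exact (LinearEquiv.ofBijective φ hφ).finrank_eq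
    have hmax : Maximal (fun S' : Subalgebra ℚ ↥C => (∀ x ∈ S', ∀ y ∈ S', x * y = y * x) ∧ IsReduced S') R' := by
      refine ⟨⟨hR'comm, hR'red⟩, fun S' hS' hR'S' y hy ↦ ?_⟩
      rw [hmem]
      refine hmaxR (y : Module.End ℚ (bettiCohomology A.X 1)) y.2 fun t ht ↦ ?_
      have h := hS'.1 y hy ⟨t, hRC ht⟩ (hR'S' ((hmem ⟨t, hRC ht⟩).2 ht))
      exact congrArg (fun z : ↥C ↦ (z : Module.End ℚ (bettiCohomology A.X 1))) h
    have h1 := (finrank_eq_reducedDegree_and_center_le_of_maximal_of_isSimpleRing R' hmax).1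
    have h2 := End.mul_reducedDegree_centralizer_eq_finrank L' hd'
    rw [← hdim, h1, h2]
    exact finrank_bettiCohomology_one A
  -- PULL BACK along the injective `a ↦ a^*`: `R₀ = {a ∈ End⁰(A) | a^* ∈ R}` (`R ⊆ E' = End⁰(A)♯`)
  let R₀ : Subalgebra ℚ A.endAlgebra := Subalgebra.unop (R.comap (bettiRepOp A))
  have hmem0 : ∀ {x : A.endAlgebra}, x ∈ R₀ ↔ bettiRepOp A (MulOpposite.op x) ∈ R := fun {x} ↦ by
    rw [Subalgebra.mem_unop, Subalgebra.mem_comap]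
  have hRred' := (isReduced_subalgebra_iff₆ R).1 hRred
  refine ⟨R₀, fun x hx ↦ ?_, fun x hx y hy ↦ ?_, ?_, ?_, fun a ha ↦ ?_⟩
  · -- `R₀ ⊆ End⁰_L(A)`
    rw [Subalgebra.mem_centralizer_iff]
    intro t ht
    have h1 : bettiRepOp A (MulOpposite.op t) ∈ S := hLS ((mem_sharp_iff A L).2 ⟨t, ht, rfl⟩)
    exact (bettiRepOp_commute_iff A).1 (hRS' _ (hmem0.1 hx) _ h1).symm
  · exact (bettiRepOp_commute_iff A).1 (hRcomm _ (hmem0.1 hx) _ (hmem0.1 hy))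
  · rw [isReduced_subalgebra_iff₆]
    rintro x hx ⟨n, hn⟩
    have h1 : bettiRepOp A (MulOpposite.op x) ^ n = 0 := by
      rw [← map_pow, ← MulOpposite.op_pow, hn, MulOpposite.op_zero, map_zero]
    have h2 : bettiRepOp A (MulOpposite.op x) = 0 := hRred' _ (hmem0.1 hx) ⟨n, h1⟩
    have h3 : bettiRepOp A (MulOpposite.op x) = bettiRepOp A (MulOpposite.op 0) := by
      rw [h2, MulOpposite.op_zero, map_zero]
    exact MulOpposite.op_injective (bettiRepOp_injective h3)
  · have hdim0 : finrank ℚ ↥R₀ = finrank ℚ ↥R := by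
      let φ : ↥R₀ →ₗ[ℚ] ↥R :=
        { toFun := fun x => ⟨bettiRepOp A (MulOpposite.op (x : A.endAlgebra)), hmem0.1 x.2⟩
          map_add' := fun x y => Subtype.ext (by
            change bettiRepOp A (MulOpposite.op ((x : A.endAlgebra) + (y : A.endAlgebra))) =
              bettiRepOp A (MulOpposite.op (x : A.endAlgebra)) + bettiRepOp A (MulOpposite.op (y : A.endAlgebra))
            rw [MulOpposite.op_add, map_add])
          map_smul' := fun c x => Subtype.ext (by
            change bettiRepOp A (MulOpposite.op (c • (x : A.endAlgebra))) =
              c • bettiRepOp A (MulOpposite.op (x : A.endAlgebra))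
            rw [MulOpposite.op_smul, map_smul]) }
      have hφ : Function.Bijective φ := by
        constructor
        · intro x y hxy
          have h1 := congrArg (fun z : ↥R => (z : Module.End ℚ (bettiCohomology A.X 1))) hxy
          exact Subtype.ext (MulOpposite.op_injective (bettiRepOp_injective h1))
        · intro y
          obtain ⟨x, hx⟩ := hmemE'.1 (hRE' y.2)
          have hxR : bettiRepOp A (MulOpposite.op x) ∈ R := by rw [hx]; exact y.2
          exact ⟨⟨x, hmem0.2 hxR⟩, Subtype.ext hx⟩
      exact (LinearEquiv.ofBijective φ hφ).finrank_eq
    rw [hdim0]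
    exact hRdim
  · -- `R₀′ = R₀`: `(a′)^* = σ (a^*) ∈ R`
    refine hmem0.2 ?_
    rw [hρr]
    exact hRσ _ (hmem0.1 ha)

/-- ★ **EX. 3.10 (a) + (b) AS AN EQUIVALENCE at the level of the abelian variety**, for a Rosati involution stabilising
`L`: `A` is of CM-type iff `End⁰_L(A)` contains a commutative reduced `R` with `d · dim_ℚ R = 2 dim A` which is STABLE
under the Rosati involution (⟸ is §4 `isOfCMType_of_mul_finrank_eq_two_mul_dim`, forgetting the stability).
[cite: MilneCM2006, Ch. I §3 Exercise 3.10 (a)(b) (p. 29)] -/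
theorem exists_rosati_stable_mul_finrank_eq_two_mul_dim_iff_isOfCMType
    (hHD : exists_isReal_hodgeModel) (hI : hodgePQ_independent_of_hodgeModel) [Module.Finite ℚ (bettiCohomology A.X 1)]
    (ψ : (BettiUniverse.hodge hHD (AbelianVariety.isSmoothProjective_holds (A := A)) 1).Polarization)
    (hd : finrank ℚ L = d ^ 2 * finrank ℚ ↥(Subalgebra.center ℚ ↥L))
    (hLr : ∀ a ∈ L, AbelianVariety.rosati A hHD hI ψ a ∈ L) :
    (∃ R : Subalgebra ℚ A.endAlgebra, R ≤ Subalgebra.centralizer ℚ (L : Set A.endAlgebra) ∧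
      (∀ x ∈ R, ∀ y ∈ R, x * y = y * x) ∧ IsReduced R ∧ d * finrank ℚ R = 2 * A.dim ∧
      ∀ a ∈ R, AbelianVariety.rosati A hHD hI ψ a ∈ R) ↔ IsOfCMType A := by
  refine ⟨fun ⟨R, hRL, hRcomm, hRred, hRdim, _⟩ ↦ ?_,
    fun h ↦ exists_rosati_stable_le_centralizer_mul_finrank_eq_two_mul_dim_of_isOfCMType L hHD hI ψ h hd hLr⟩
  haveI := hRred
  exact isOfCMType_of_mul_finrank_eq_two_mul_dim A L hd R hRcomm hRL hRdim

/-- ★★ **THE CASE `L = ℚ` (`d = 1`): MILNE CM PROP. 3.6 (c), the Rosati clause, for EVERY polarization** — «An abelian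
variety `A` has complex multiplication if and only if `End⁰(A)` contains an étale `ℚ`-algebra (which can be chosen to
be […] invariant under some Rosati involution) of degree `2 dim A` over `ℚ`»: if `A` is of CM-type, then for every
polarization `ψ` of `H¹(A(ℂ); ℚ)` the algebra `End⁰(A)` contains a commutative reduced `R` of dimension `2 dim A` stable
under the Rosati involution of `ψ` (the CM-algebra refinement is not asserted here).
[cite: MilneCM2006, Ch. I §3 Prop. 3.6 (c) (p. 28), Exercise 3.10 (b) (p. 29)] -/
theorem exists_rosati_stable_finrank_eq_two_mul_dim_of_isOfCMType [Nontrivial A.endAlgebra]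
    (hHD : exists_isReal_hodgeModel) (hI : hodgePQ_independent_of_hodgeModel) [Module.Finite ℚ (bettiCohomology A.X 1)]
    (ψ : (BettiUniverse.hodge hHD (AbelianVariety.isSmoothProjective_holds (A := A)) 1).Polarization)
    (h : IsOfCMType A) :
    ∃ R : Subalgebra ℚ A.endAlgebra, (∀ x ∈ R, ∀ y ∈ R, x * y = y * x) ∧ IsReduced R ∧
      finrank ℚ R = 2 * A.dim ∧ ∀ a ∈ R, AbelianVariety.rosati A hHD hI ψ a ∈ R := by
  haveI : IsSimpleRing ↥(⊥ : Subalgebra ℚ A.endAlgebra) :=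
    IsSimpleRing.of_ringEquiv (Algebra.botEquiv ℚ A.endAlgebra).symm.toRingEquiv inferInstance
  -- `ℚ · 1` is commutative, so `[ℚ·1 : ℚ] = 1² · [Z(ℚ·1) : ℚ]`
  have hc : Subalgebra.center ℚ ↥(⊥ : Subalgebra ℚ A.endAlgebra) = ⊤ :=
    eq_top_iff.2 fun x _ => Subalgebra.mem_center_iff.2 fun y => by
      obtain ⟨q, hq⟩ := Algebra.mem_bot.1 x.2
      apply Subtype.ext
      rw [Subalgebra.coe_mul, Subalgebra.coe_mul, ← hq]
      exact (Algebra.commutes q (y : A.endAlgebra)).symm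
  have hd : finrank ℚ ↥(⊥ : Subalgebra ℚ A.endAlgebra) =
      1 ^ 2 * finrank ℚ ↥(Subalgebra.center ℚ ↥(⊥ : Subalgebra ℚ A.endAlgebra)) := by
    rw [one_pow, one_mul, hc]
    exact (Subalgebra.topEquiv (R := ℚ) (A := ↥(⊥ : Subalgebra ℚ A.endAlgebra))).toLinearEquiv.finrank_eq.symm
  -- `ℚ · 1` is Rosati-stable: `(q · 1)′ = q · 1′ = q · 1` (`(1′)^* = (1^*)† = 1 = 1^*`)
  have h1 : AbelianVariety.rosati A hHD hI ψ 1 = 1 := by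
    apply bettiRep_injective
    apply MulOpposite.unop_injective
    rw [AbelianVariety.unop_bettiRep_rosati, map_one, MulOpposite.unop_one, ψ.adjoint_one]
  have hLr : ∀ a ∈ (⊥ : Subalgebra ℚ A.endAlgebra), AbelianVariety.rosati A hHD hI ψ a ∈ (⊥ : Subalgebra ℚ A.endAlgebra) := by
    intro a ha
    obtain ⟨q, rfl⟩ := Algebra.mem_bot.1 ha
    rw [Algebra.algebraMap_eq_smul_one, map_smul, h1]
    exact Subalgebra.smul_mem _ (Subalgebra.one_mem _) q
  obtain ⟨R, -, hRcomm, hRred, hRdim, hRr⟩ :=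
    exists_rosati_stable_le_centralizer_mul_finrank_eq_two_mul_dim_of_isOfCMType ⊥ hHD hI ψ h hd hLr
  exact ⟨R, hRcomm, hRred, by rwa [one_mul] at hRdim, hRr⟩

end RosatiStable

end Literature.AlgebraicGeometry.ComplexMultiplication

end
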